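import Literature.Analysis.FluidPDE.MVRelativeEnergyPointwiseBounds
import HarnessLib

/-!
# The integrands of the measure-valued relative-energy inequality (Březina–Feireisl 2018, §3.1.1)

Fix the point data `d` of a strong solution (`StrongPointData`). Testing the continuity,
momentum and entropy identities of a dissipative measure-valued solution (BF (2.20)–(2.22),
`DissipativeMVEuler.IsDissipativeMVSolution`) with BF's test functions `φ₁ = ½|U|² - μ(r,Θ)`,
`U`, `Θ` produces, inside the brackets `⟨Y_{t,x}; ·⟩`, the phase-space functions

* `contI d w = ρ ∂ₜφ₁ + m·∇φ₁`, `momI d w = m·∂ₜU + (m⊗m/ρ):∇U + p(ρ,E) divU`,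
  `entI Z d w = ρ Z(s) ∂ₜΘ + Z(s) m·∇Θ`, with `rawRHS = -momI + contI - entI + ∂ₜp(r,Θ)`
  (`rawRHS_eq_pieces`);
* the relative energy with cut-off `relEnergyZ Z d w = ½|m|²/ρ + E - m·U + ρφ₁ - Θ ρ Z(s) + p(r,Θ)`
  (BF (3.3) expanded as in (3.4)), equal on the open quadrant to
  `relEnergyFull + Θ ρ (s - Z(s))` (`relEnergyZ_eq`);
* the moment function `momentFun` of the field `moment_bound` (BF (2.8)–(2.11)), which dominates
  all of the above on the quadrant (`abs_contI_le`, `abs_momI_le`, `abs_entI_le`,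
  `abs_relEnergyZ_le`), and the open quadrant `phaseQuadrant` of the phase space.

## References

* J. Březina, E. Feireisl, J. Math. Soc. Japan 70 (2018), §3.1.1 (3.3)–(3.5), Def. 2.9.
-/

noncomputable section

open Set Function Finset
open scoped BigOperators

namespace Literature.Analysis.FluidPDE

namespace CompressibleEuler

open EulerPhase StrongPointData EulerEOS

/-! ## The open quadrant of the phase space and the moment function -/

/-- The open quadrant `{ρ > 0, E > 0}` of the phase space `F`. [cite: BrezinaFeireisl2018, §3.2] -/
def phaseQuadrant : Set EulerPhase := {w | 0 < dens w ∧ 0 < ien w}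

/-- The open quadrant is open. [folklore] -/
theorem isOpen_phaseQuadrant : IsOpen phaseQuadrant :=
  (isOpen_lt continuous_const continuous_fst).inter
    (isOpen_lt continuous_const (continuous_fst.comp continuous_snd))

/-- The open quadrant is measurable. [folklore] -/
theorem measurableSet_phaseQuadrant : MeasurableSet phaseQuadrant :=
  isOpen_phaseQuadrant.measurableSet

/-- The moment function of the field `moment_bound` of `IsDissipativeMVSolution`:
`ρ + |m| + ½|m|²/ρ + E + |p(ρ,E)|`. [cite: BrezinaFeireisl2018, (2.8)–(2.11)] -/
def momentFun (ceos : ConservativeEOS) (w : EulerPhase) : ℝ :=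
  dens w + ‖mom w‖ + kineticEnergy w + ien w + |ceos.pressure (dens w) (ien w)|

section MomentFun

variable {ceos : ConservativeEOS} {w : EulerPhase}

/-- `ρ ≤ momentFun` on the quadrant. [folklore] -/
theorem dens_le_momentFun (hw : w ∈ phaseQuadrant) : dens w ≤ momentFun ceos w := by
  unfold momentFun
  have := kineticEnergy_nonneg hw.1.le
  have := hw.2.le
  have := norm_nonneg (mom w)
  have := abs_nonneg (ceos.pressure (dens w) (ien w))
  linarith

/-- `|m| ≤ momentFun` on the quadrant. [folklore] -/
theorem norm_mom_le_momentFun (hw : w ∈ phaseQuadrant) : ‖mom w‖ ≤ momentFun ceos w := by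
  unfold momentFun
  have := kineticEnergy_nonneg hw.1.le
  have := hw.2.le
  have := hw.1.le
  have := abs_nonneg (ceos.pressure (dens w) (ien w))
  linarith

/-- `½|m|²/ρ ≤ momentFun` on the quadrant. [folklore] -/
theorem kineticEnergy_le_momentFun (hw : w ∈ phaseQuadrant) :
    kineticEnergy w ≤ momentFun ceos w := by
  unfold momentFun
  have := hw.2.le
  have := hw.1.le
  have := norm_nonneg (mom w)
  have := abs_nonneg (ceos.pressure (dens w) (ien w))
  linarith

/-- `E ≤ momentFun` on the quadrant. [folklore] -/
theorem ien_le_momentFun (hw : w ∈ phaseQuadrant) : ien w ≤ momentFun ceos w := by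
  unfold momentFun
  have := kineticEnergy_nonneg hw.1.le
  have := hw.1.le
  have := norm_nonneg (mom w)
  have := abs_nonneg (ceos.pressure (dens w) (ien w))
  linarith

/-- `|p(ρ,E)| ≤ momentFun` on the quadrant. [folklore] -/
theorem abs_pressure_le_momentFun (hw : w ∈ phaseQuadrant) :
    |ceos.pressure (dens w) (ien w)| ≤ momentFun ceos w := by
  unfold momentFun
  have := kineticEnergy_nonneg hw.1.le
  have := hw.1.le
  have := hw.2.le
  have := norm_nonneg (mom w)
  linarith

/-- `0 ≤ momentFun` on the quadrant. [folklore] -/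
theorem momentFun_nonneg (hw : w ∈ phaseQuadrant) : 0 ≤ momentFun ceos w :=
  hw.1.le.trans (dens_le_momentFun hw)

/-- `|mᵢ| ≤ momentFun`. [folklore] -/
theorem abs_mom_apply_le_momentFun (hw : w ∈ phaseQuadrant) (i : Fin 3) :
    |mom w i| ≤ momentFun ceos w :=
  (Real.norm_eq_abs _ ▸ PiLp.norm_apply_le (mom w) i).trans (norm_mom_le_momentFun hw)

/-- `∑ᵢ |mᵢ| ≤ 3 momentFun`. [folklore] -/
theorem sum_abs_mom_le (hw : w ∈ phaseQuadrant) : ∑ i, |mom w i| ≤ 3 * momentFun ceos w := by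
  calc ∑ i, |mom w i| ≤ ∑ _i : Fin 3, momentFun ceos w :=
        sum_le_sum fun i _ => abs_mom_apply_le_momentFun hw i
    _ = 3 * momentFun ceos w := by simp

/-- `|mᵢ mⱼ|/ρ ≤ ½|m|²/ρ·2 = 2·kineticEnergy` summed: `∑ᵢⱼ |mᵢ mⱼ|/ρ ≤ 6 · kineticEnergy`. [folklore] -/
theorem sum_sum_abs_mom_mul_div_le (hw : w ∈ phaseQuadrant) :
    ∑ i, ∑ j, |mom w i * mom w j / dens w| ≤ 6 * kineticEnergy w := by
  have hρ := hw.1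
  have h1 : ∑ i, ∑ j, |mom w i * mom w j / dens w| = (∑ i, |mom w i|) ^ 2 / dens w := by
    rw [sq, sum_mul_sum, sum_div]
    refine sum_congr rfl fun i _ => ?_
    rw [sum_div]
    refine sum_congr rfl fun j _ => ?_
    rw [abs_div, abs_mul, abs_of_pos hρ]
  rw [h1, div_le_iff₀ hρ]
  have h2 := sq_sum_abs_le_three (fun i => mom w i)
  have h3 : ∑ i, (mom w i) ^ 2 = ‖mom w‖ ^ 2 := by
    rw [EuclideanSpace.real_norm_sq_eq]
  unfold kineticEnergy
  rw [h3] at h2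
  have : 6 * (‖mom w‖ ^ 2 / (2 * dens w)) * dens w = 3 * ‖mom w‖ ^ 2 := by
    field_simp; ring
  rw [this]
  exact h2

end MomentFun

/-! ## The integrands -/

namespace StrongPointData

/-- The continuity-equation integrand `ρ ∂ₜφ₁ + m·∇φ₁`. [cite: BrezinaFeireisl2018, (3.4)] -/
def contI (eos : EulerEOS) (d : StrongPointData) (w : EulerPhase) : ℝ :=
  dens w * d.φ₁t eos + ∑ i, mom w i * d.gφ₁ eos i

/-- The momentum-equation integrand `m·∂ₜU + (m⊗m/ρ):∇U + p(ρ,E) divU`.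
[cite: BrezinaFeireisl2018, (3.4)] -/
def momI (eos : EulerEOS) (d : StrongPointData) (w : EulerPhase) : ℝ :=
  (∑ i, mom w i * d.Ut i) + (∑ i, ∑ j, mom w i * mom w j / dens w * d.gU i j) +
    eos.p (dens w) (stateTemp eos (dens w) (ien w)) * d.divU

/-- The entropy-inequality integrand `ρ Z(s) ∂ₜΘ + Z(s) m·∇Θ`. [cite: BrezinaFeireisl2018, (3.4)] -/
def entI (eos : EulerEOS) (Z : ℝ → ℝ) (d : StrongPointData) (w : EulerPhase) : ℝ :=
  dens w * Z (eos.s (dens w) (stateTemp eos (dens w) (ien w))) * d.Θt +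
    ∑ i, Z (eos.s (dens w) (stateTemp eos (dens w) (ien w))) * mom w i * d.gΘ i

/-- BF's relative energy with cut-off, expanded as in (3.4):
`½|m|²/ρ + E - m·U + ρ(½|U|² - μ(r,Θ)) - Θ ρ Z(s(ρ,E)) + p(r,Θ)`.
[cite: BrezinaFeireisl2018, (3.3)–(3.4)] -/
def relEnergyZ (eos : EulerEOS) (Z : ℝ → ℝ) (d : StrongPointData) (w : EulerPhase) : ℝ :=
  kineticEnergy w + ien w - (∑ i, mom w i * d.U i) +
    dens w * (‖d.U‖ ^ 2 / 2 - eos.chemPotential d.r d.Θ) -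
    d.Θ * (dens w * Z (eos.s (dens w) (stateTemp eos (dens w) (ien w)))) + eos.p d.r d.Θ

end StrongPointData

variable {eos : EulerEOS}

/-- `rawRHS = -momI + contI - entI + ∂ₜp(r,Θ)`. [cite: BrezinaFeireisl2018, (3.5)] -/
theorem rawRHS_eq_pieces (Z : ℝ → ℝ) (d : StrongPointData) (w : EulerPhase) :
    rawRHS eos Z d (dens w) (ien w) (mom w) =
      -d.momI eos w + d.contI eos w - d.entI eos Z w + d.pt eos := by
  unfold rawRHS momI contI entI
  ring

/-- **On the open quadrant `relEnergyZ = relEnergyFull + Θ ρ (s - Z(s))`** (uses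
`E = ρ e(ρ,ϑ(ρ,E))` and `r μ(r,Θ) - H_Θ(r,Θ) = p(r,Θ)`). [cite: BrezinaFeireisl2018, §3.2.1] -/
theorem relEnergyZ_eq (Z : ℝ → ℝ) (d : StrongPointData) (hr : d.r ≠ 0) {w : EulerPhase}
    (hρ : 0 < dens w)
    (hE : dens w * eos.e (dens w) (stateTemp eos (dens w) (ien w)) = ien w) :
    d.relEnergyZ eos Z w = relEnergyFull eos d (dens w) (ien w) (mom w) +
      d.Θ * dens w * (eos.s (dens w) (stateTemp eos (dens w) (ien w)) -
        Z (eos.s (dens w) (stateTemp eos (dens w) (ien w)))) := by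
  have hρ' : dens w ≠ 0 := hρ.ne'
  have hn1 : ‖mom w‖ ^ 2 = ∑ i, mom w i ^ 2 := by
    rw [EuclideanSpace.real_norm_sq_eq]
  have hn2 : ‖d.U‖ ^ 2 = ∑ i, d.U i ^ 2 := by
    rw [EuclideanSpace.real_norm_sq_eq]
  unfold relEnergyZ relEnergyFull relEnergyThermo ballisticFreeEnergy chemPotential kineticEnergy
  rw [hn1, hn2, hE]
  simp only [Fin.sum_univ_three]
  field_simp
  ring

/-! ## Domination by the moment function -/

section Domination

variable {d : StrongPointData} {w : EulerPhase} {N M Zb : ℝ}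

/-- `|contI| ≤ 4N · momentFun` when `|∂ₜφ₁|, |∂ⱼφ₁| ≤ N`. [folklore] -/
theorem abs_contI_le (hw : w ∈ phaseQuadrant) (hN : |d.φ₁t eos| ≤ N)
    (hN' : ∀ i, |d.gφ₁ eos i| ≤ N) :
    |d.contI eos w| ≤ 4 * N * momentFun eos.toConservative w := by
  have hΦ := momentFun_nonneg (ceos := eos.toConservative) hw
  have hN0 : 0 ≤ N := (abs_nonneg _).trans hN
  have h1 : |dens w * d.φ₁t eos| ≤ N * momentFun eos.toConservative w := by
    rw [abs_mul, abs_of_pos hw.1, mul_comm]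
    exact mul_le_mul hN (dens_le_momentFun hw) hw.1.le hN0
  have h2 : |∑ i, mom w i * d.gφ₁ eos i| ≤ 3 * N * momentFun eos.toConservative w := by
    have : ∑ i, mom w i * d.gφ₁ eos i = ∑ i, d.gφ₁ eos i * mom w i :=
      sum_congr rfl fun i _ => mul_comm _ _
    rw [this]
    calc |∑ i, d.gφ₁ eos i * mom w i| ≤ N * ∑ i, |mom w i| := abs_sum_mul_le Finset.univ fun i _ => hN' i
      _ ≤ N * (3 * momentFun eos.toConservative w) :=
          mul_le_mul_of_nonneg_left (sum_abs_mom_le hw) hN0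
      _ = 3 * N * momentFun eos.toConservative w := by ring
  unfold contI
  calc _ ≤ |dens w * d.φ₁t eos| + |∑ i, mom w i * d.gφ₁ eos i| := abs_add_le _ _
    _ ≤ _ := by linarith

/-- `|momI| ≤ (3M + 6M + 3M) momentFun = 12 M · momentFun` when the data are bounded by `M`.
[folklore] -/
theorem abs_momI_le (hw : w ∈ phaseQuadrant) (hB : d.Bounded M) :
    |d.momI eos w| ≤ 12 * M * momentFun eos.toConservative w := by
  have hΦ := momentFun_nonneg (ceos := eos.toConservative) hw
  have hM0 : 0 ≤ M := (abs_nonneg _).trans hB.1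
  have h1 : |∑ i, mom w i * d.Ut i| ≤ 3 * M * momentFun eos.toConservative w := by
    have : ∑ i, mom w i * d.Ut i = ∑ i, d.Ut i * mom w i := sum_congr rfl fun i _ => mul_comm _ _
    rw [this]
    calc |∑ i, d.Ut i * mom w i| ≤ M * ∑ i, |mom w i| := abs_sum_mul_le Finset.univ fun i _ => hB.2.2.2.1 i
      _ ≤ M * (3 * momentFun eos.toConservative w) :=
          mul_le_mul_of_nonneg_left (sum_abs_mom_le hw) hM0
      _ = 3 * M * momentFun eos.toConservative w := by ring
  have h2 : |∑ i, ∑ j, mom w i * mom w j / dens w * d.gU i j| ≤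
      6 * M * momentFun eos.toConservative w := by
    calc |∑ i, ∑ j, mom w i * mom w j / dens w * d.gU i j|
        ≤ ∑ i, |∑ j, mom w i * mom w j / dens w * d.gU i j| := abs_sum_le_sum_abs _ _
      _ ≤ ∑ i, ∑ j, |mom w i * mom w j / dens w| * M := sum_le_sum fun i _ =>
          (abs_sum_le_sum_abs _ _).trans (sum_le_sum fun j _ => by
            rw [abs_mul]
            exact mul_le_mul_of_nonneg_left (hB.2.2.2.2.2.2 i j) (abs_nonneg _))
      _ = (∑ i, ∑ j, |mom w i * mom w j / dens w|) * M := by rw [sum_mul]; simp [sum_mul]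
      _ ≤ 6 * kineticEnergy w * M :=
          mul_le_mul_of_nonneg_right (sum_sum_abs_mom_mul_div_le hw) hM0
      _ ≤ 6 * momentFun eos.toConservative w * M := by
          have := kineticEnergy_le_momentFun (ceos := eos.toConservative) hw
          nlinarith
      _ = 6 * M * momentFun eos.toConservative w := by ring
  have h3 : |eos.p (dens w) (stateTemp eos (dens w) (ien w)) * d.divU| ≤
      3 * M * momentFun eos.toConservative w := by
    rw [abs_mul]
    have hp : |eos.p (dens w) (stateTemp eos (dens w) (ien w))| ≤ momentFun eos.toConservative w :=
      abs_pressure_le_momentFun (ceos := eos.toConservative) hw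
    calc _ ≤ momentFun eos.toConservative w * (3 * M) :=
          mul_le_mul hp hB.abs_divU_le (abs_nonneg _) hΦ
      _ = _ := by ring
  unfold momI
  calc _ ≤ |(∑ i, mom w i * d.Ut i) + ∑ i, ∑ j, mom w i * mom w j / dens w * d.gU i j| +
        |eos.p (dens w) (stateTemp eos (dens w) (ien w)) * d.divU| := abs_add_le _ _
    _ ≤ |∑ i, mom w i * d.Ut i| + |∑ i, ∑ j, mom w i * mom w j / dens w * d.gU i j| +
        |eos.p (dens w) (stateTemp eos (dens w) (ien w)) * d.divU| := by
          linarith [abs_add_le (∑ i, mom w i * d.Ut i) (∑ i, ∑ j, mom w i * mom w j / dens w * d.gU i j)]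
    _ ≤ _ := by linarith

/-- `|entI| ≤ 4 Zb M · momentFun` when `|Z| ≤ Zb` and the data are bounded by `M`. [folklore] -/
theorem abs_entI_le {Z : ℝ → ℝ} (hw : w ∈ phaseQuadrant) (hB : d.Bounded M)
    (hZb : ∀ x, |Z x| ≤ Zb) : |d.entI eos Z w| ≤ 4 * Zb * M * momentFun eos.toConservative w := by
  have hΦ := momentFun_nonneg (ceos := eos.toConservative) hw
  have hM0 : 0 ≤ M := (abs_nonneg _).trans hB.1
  have hZb0 : 0 ≤ Zb := (abs_nonneg _).trans (hZb 0)
  set ζ := Z (eos.s (dens w) (stateTemp eos (dens w) (ien w))) with hζ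
  have hζb : |ζ| ≤ Zb := hZb _
  have h1 : |dens w * ζ * d.Θt| ≤ Zb * M * momentFun eos.toConservative w := by
    rw [abs_mul, abs_mul, abs_of_pos hw.1]
    calc dens w * |ζ| * |d.Θt| ≤ momentFun eos.toConservative w * Zb * M :=
          mul_le_mul (mul_le_mul (dens_le_momentFun hw) hζb (abs_nonneg _) hΦ) hB.2.1
            (abs_nonneg _) (by positivity)
      _ = Zb * M * momentFun eos.toConservative w := by ring
  have h2 : |∑ i, ζ * mom w i * d.gΘ i| ≤ 3 * Zb * M * momentFun eos.toConservative w := by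
    have : ∑ i, ζ * mom w i * d.gΘ i = ∑ i, (ζ * d.gΘ i) * mom w i :=
      sum_congr rfl fun i _ => by ring
    rw [this]
    have hco : ∀ i ∈ Finset.univ, |ζ * d.gΘ i| ≤ Zb * M := fun i _ => by
      rw [abs_mul]; exact mul_le_mul hζb (hB.2.2.2.2.2.1 i) (abs_nonneg _) hZb0
    calc |∑ i, (ζ * d.gΘ i) * mom w i| ≤ Zb * M * ∑ i, |mom w i| :=
          abs_sum_mul_le Finset.univ hco
      _ ≤ Zb * M * (3 * momentFun eos.toConservative w) :=
          mul_le_mul_of_nonneg_left (sum_abs_mom_le hw) (by positivity)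
      _ = 3 * Zb * M * momentFun eos.toConservative w := by ring
  unfold entI
  calc _ ≤ |dens w * ζ * d.Θt| + |∑ i, ζ * mom w i * d.gΘ i| := abs_add_le _ _
    _ ≤ _ := by linarith

/-- `|relEnergyZ| ≤ (2 + 3M + N + |Θ| Zb) momentFun + N` when `|Z| ≤ Zb`, data bounded by `M`,
`|½|U|² - μ(r,Θ)| ≤ N`, `|p(r,Θ)| ≤ N`. [folklore] -/
theorem abs_relEnergyZ_le {Z : ℝ → ℝ} (hw : w ∈ phaseQuadrant) (hB : d.Bounded M)
    (hZb : ∀ x, |Z x| ≤ Zb) (hφ : |‖d.U‖ ^ 2 / 2 - eos.chemPotential d.r d.Θ| ≤ N)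
    (hp : |eos.p d.r d.Θ| ≤ N) :
    |d.relEnergyZ eos Z w| ≤ (2 + 3 * M + N + |d.Θ| * Zb) * momentFun eos.toConservative w + N := by
  have hΦ := momentFun_nonneg (ceos := eos.toConservative) hw
  have hM0 : 0 ≤ M := (abs_nonneg _).trans hB.1
  have hN0 : 0 ≤ N := (abs_nonneg _).trans hp
  have hZb0 : 0 ≤ Zb := (abs_nonneg _).trans (hZb 0)
  have hkin := kineticEnergy_le_momentFun (ceos := eos.toConservative) hw
  have hkin0 := kineticEnergy_nonneg hw.1.le
  have hien := ien_le_momentFun (ceos := eos.toConservative) hw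
  have hdens := dens_le_momentFun (ceos := eos.toConservative) hw
  have h1 : |∑ i, mom w i * d.U i| ≤ 3 * M * momentFun eos.toConservative w := by
    have : ∑ i, mom w i * d.U i = ∑ i, d.U i * mom w i := sum_congr rfl fun i _ => mul_comm _ _
    rw [this]
    calc |∑ i, d.U i * mom w i| ≤ M * ∑ i, |mom w i| := abs_sum_mul_le Finset.univ fun i _ => hB.2.2.1 i
      _ ≤ M * (3 * momentFun eos.toConservative w) :=
          mul_le_mul_of_nonneg_left (sum_abs_mom_le hw) hM0
      _ = 3 * M * momentFun eos.toConservative w := by ring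
  have h2 : |dens w * (‖d.U‖ ^ 2 / 2 - eos.chemPotential d.r d.Θ)| ≤
      N * momentFun eos.toConservative w := by
    rw [abs_mul, abs_of_pos hw.1, mul_comm]
    exact mul_le_mul hφ hdens hw.1.le hN0
  have h3 : |d.Θ * (dens w * Z (eos.s (dens w) (stateTemp eos (dens w) (ien w))))| ≤
      |d.Θ| * Zb * momentFun eos.toConservative w := by
    rw [abs_mul, abs_mul, abs_of_pos hw.1]
    calc |d.Θ| * (dens w * |Z (eos.s (dens w) (stateTemp eos (dens w) (ien w)))|) ≤
        |d.Θ| * (momentFun eos.toConservative w * Zb) :=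
          mul_le_mul_of_nonneg_left (mul_le_mul hdens (hZb _) (abs_nonneg _) hΦ) (abs_nonneg _)
      _ = |d.Θ| * Zb * momentFun eos.toConservative w := by ring
  have a1 := abs_le.1 h1
  have a2 := abs_le.1 h2
  have a3 := abs_le.1 h3
  have a4 := abs_le.1 hp
  have hien0 := hw.2.le
  have hx : 0 ≤ |d.Θ| * Zb * momentFun eos.toConservative w := by positivity
  have e : (2 + 3 * M + N + |d.Θ| * Zb) * momentFun eos.toConservative w =
      2 * momentFun eos.toConservative w + 3 * M * momentFun eos.toConservative w +
        N * momentFun eos.toConservative w + |d.Θ| * Zb * momentFun eos.toConservative w := by ring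
  unfold relEnergyZ
  rw [abs_le, e]
  constructor
  · linarith
  · linarith

/-- `|rawRHS| ≤ (12M + 4N + 4 Zb M) momentFun + N` when additionally `|∂ₜp(r,Θ)| ≤ N`.
[folklore] -/
theorem abs_rawRHS_le {Z : ℝ → ℝ} (hw : w ∈ phaseQuadrant) (hB : d.Bounded M)
    (hZb : ∀ x, |Z x| ≤ Zb) (hN : |d.φ₁t eos| ≤ N) (hN' : ∀ i, |d.gφ₁ eos i| ≤ N)
    (hpt : |d.pt eos| ≤ N) :
    |rawRHS eos Z d (dens w) (ien w) (mom w)| ≤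
      (12 * M + 4 * N + 4 * Zb * M) * momentFun eos.toConservative w + N := by
  rw [rawRHS_eq_pieces]
  have h1 := abs_momI_le (eos := eos) hw hB
  have h2 := abs_contI_le (eos := eos) hw hN hN'
  have h3 := abs_entI_le (eos := eos) hw hB hZb
  have a1 := abs_le.1 h1; have a2 := abs_le.1 h2; have a3 := abs_le.1 h3; have a4 := abs_le.1 hpt
  rw [abs_le]
  constructor <;> linarith

end Domination

end CompressibleEuler

end Literature.Analysis.FluidPDE
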